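import Summits.NavierStokesRegularity.NavierStokesRegularity.Theorems.QuietScarPocketDoorDefs
import Summits.NavierStokesRegularity.NavierStokesRegularity.Theorems.QuietScarPocketDoorZoomTopBounds
import Summits.NavierStokesRegularity.NavierStokesRegularity.Theorems.QuietScarPocketDoorZoomTopLimit
import Summits.NavierStokesRegularity.NavierStokesRegularity.Theorems.LocalIrrotationalScarDoorZoomTopFading
import Literature.Analysis.FluidPDE.TypeIAncientMild
import HarnessLib

/-!
# Door S31 `QuietScarPocketDoor`, K-piece PK1 `scarPocketZoom_holds` — STUB F4a `exists_topCurl_of_classZoom`: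
# the top curl trace of the class zoom off the apex, and its vanishing on the pocket

Width-seat file (prover ns-imp-p1 g4 under LEAD ns-s30-p1, LEAD WORD 2026-08-28T10:27:31Z; PK1 skeleton
`PK1-Skeleton.lean` sha16 e9d92a063109a968, stub F4a, signature VERBATIM with `E³`/`𝕊` spelled out).

**Statement (F4a).**  Along the class zoom of F3 — classical zooms `w k` on `Q(R_k, 0)`, `R_k → ∞`, with the
one-point bound `‖w k (s,y)‖ ≤ C_u/(√(−s)+‖y‖)`, Albritton–Barker quantity `𝐈 ≤ I`, pocket centres `e_k → e`,
quietness levels `ε_k → 0` (`‖curl (w k)(s, y)‖ ≤ ε_k` eventually as `s ↑ 0`, for `y ∈ B(e_k, κ)`), converging in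
`L³_loc` of the backward slab to a Type-I ancient mild field `U` — the curls `curl U(s, ·)` converge as `s ↑ 0`,
locally uniformly off the apex, to a trace `Ω₀` continuous on `ℝ³∖{0}` (`TopCurlTendsto U Ω₀`) which VANISHES on
the pocket `B(e, κ)`.

**Proof.**  (R, `…ZoomTopBounds`) at every `y₀ ≠ 0`, eventually in `k`, ONE `(K, C, α₀, α₁)`: on
`Q((0,y₀), ‖y₀‖/8)` the zooms have `‖D_xⁿ‖ ≤ K` (`n ≤ 2`) and `w k`, `D_x(w k)` are jointly Hölder up to the
top (Seregin–Šverák 2009 §2 with the ball-mean pressure gauge, mass `≤ c²·I`).  (L, `…ZoomTopLimit`)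
`L³(Q(0,r))` convergence gives an a.e.-convergent subsequence, upgraded to EVERYWHERE convergence on the
off-apex cylinder by the equi-Hölder bound and the continuity of `U`; the uniform `D²` bound turns convergence
of values into convergence of gradients (`…ZoomTraceTools.tendsto_fderiv_of_tendsto_of_taylor`), so the joint
Hölder modulus of `D_x(w k)` passes to `D_x U` on `Q((0,y₀), ‖y₀‖/16)`; its time part makes `curl U(s,·)`
uniformly Cauchy as `s ↑ 0` near `y₀`, whence the trace `Ω₀(x) := lim_{s↑0} curl U(s,x)`, the local uniform
convergence (`TopCurlTendsto`) and the continuity of `Ω₀`.  (P) For `y ∈ B(e,κ)` eventually `y ∈ B(e_k,κ)`; the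
eventual-in-`s` pocket bound and the `k`-uniform time-Hölder modulus of `curl (w k)(·, y)` give
`‖curl (w k)(s,y)‖ ≤ ε_k + ‖curl‖·C·(−s)^{α}` for ALL `s ∈ (−(‖y‖/16)², 0)` and all large `k`; letting `k → ∞`
along the subsequence and then `s ↑ 0` gives `Ω₀(y) = 0`.

The limit's own suitable-weak data (`hsw`, `hwg`, `hIU`) and the bookkeeping hypotheses `hRk1`, `hek1`, `hε0` are
part of the registered interface but are not needed by this proof (the regularity of the limit is INHERITED from
the zooms' uniform estimates rather than re-derived from `(U, P)`).

HONEST FRAMING: a by-name helper for item 0056 (`--supports … --as helper`); door S31, PK1 (`ScarPocketZoom`),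
item 0056 `NoTypeII` and the summit are OPEN; the zooms and their limit are HYPOTHETICAL blow-up objects; nothing
here is a statement about Navier–Stokes regularity.
-/

noncomputable section

set_option linter.dupNamespace false

namespace Summit.NavierStokesRegularity.NavierStokesRegularity.Theorems.QuietScarPocketDoor

open MeasureTheory Set Function Filter Topology TopologicalSpace Metric
open scoped NNReal ENNReal Topology
open Literature.Analysis Literature.Analysis.FluidPDE
open Summit.NavierStokesRegularity.NavierStokesRegularity.Theorems.LocalIrrotationalScarDoorZoomTraceTools
  (tendsto_fderiv_of_tendsto_of_taylor)
open Summit.NavierStokesRegularity.NavierStokesRegularity.Theorems.LocalIrrotationalScarDoorZoomTopFading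
  (taylor_bound_of_iteratedFDeriv_two)
open Summit.NavierStokesRegularity.NavierStokesRegularity.Theorems.LocalIrrotationalScarDoorZoomDataTop
  (mem_parabolicCylinder_top_iff)

/-! ## Geometry of the off-apex top cylinders -/

/-- `Q((0,y₀), ‖y₀‖/16) ⊆ Q((0,y₀), ‖y₀‖/8)`. -/
theorem topCylinder_sixteenth_subset_eighth (y₀ : EuclideanSpace ℝ (Fin 3)) :
    parabolicCylinder (‖y₀‖ / 16) (((0 : ℝ), y₀) : ℝ × EuclideanSpace ℝ (Fin 3)) ⊆
      parabolicCylinder (‖y₀‖ / 8) (((0 : ℝ), y₀) : ℝ × EuclideanSpace ℝ (Fin 3)) :=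
  parabolicCylinder_mono (by positivity) (by linarith [norm_nonneg y₀]) _

/-- Slices of the small cylinder: if `(s, x) ∈ Q((0,y₀), ‖y₀‖/16)` and `y ∈ B(x, ‖y₀‖/16)` then
`(s, y) ∈ Q((0,y₀), ‖y₀‖/8)`. -/
theorem mem_topCylinder_eighth_of_ball {y₀ x y : EuclideanSpace ℝ (Fin 3)} {s : ℝ}
    (hz : ((s, x) : ℝ × EuclideanSpace ℝ (Fin 3)) ∈
      parabolicCylinder (‖y₀‖ / 16) (((0 : ℝ), y₀) : ℝ × EuclideanSpace ℝ (Fin 3)))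
    (hy : y ∈ ball x (‖y₀‖ / 16)) :
    ((s, y) : ℝ × EuclideanSpace ℝ (Fin 3)) ∈
      parabolicCylinder (‖y₀‖ / 8) (((0 : ℝ), y₀) : ℝ × EuclideanSpace ℝ (Fin 3)) := by
  rw [mem_parabolicCylinder_top_iff] at hz ⊢
  obtain ⟨⟨h1, h2⟩, h3⟩ := hz
  simp only at h1 h2 h3 ⊢
  refine ⟨⟨by nlinarith [norm_nonneg y₀], h2⟩, ?_⟩
  calc dist y y₀ ≤ dist y x + dist x y₀ := dist_triangle _ _ _
    _ < ‖y₀‖ / 16 + ‖y₀‖ / 16 := add_lt_add (mem_ball.1 hy) h3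
    _ = ‖y₀‖ / 8 := by ring

/-- Points of the small top cylinder have negative time. -/
theorem neg_of_mem_topCylinder {y₀ : EuclideanSpace ℝ (Fin 3)} {ρ : ℝ} {z : ℝ × EuclideanSpace ℝ (Fin 3)}
    (hz : z ∈ parabolicCylinder ρ (((0 : ℝ), y₀) : ℝ × EuclideanSpace ℝ (Fin 3))) : z.1 < 0 := by
  rw [mem_parabolicCylinder_top_iff] at hz
  exact hz.1.2

/-- The curl is `‖curl‖`-Lipschitz in the gradient. -/
theorem dist_curl_le (u v : EuclideanSpace ℝ (Fin 3) → EuclideanSpace ℝ (Fin 3)) (x y : EuclideanSpace ℝ (Fin 3)) :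
    dist (curl u x) (curl v y) ≤ ‖curlCLM‖ * dist (fderiv ℝ u x) (fderiv ℝ v y) := by
  rw [curl_eq_curlCLM, curl_eq_curlCLM, dist_eq_norm, dist_eq_norm, ← map_sub]
  exact curlCLM.le_opNorm _

/-- Time distance in the product metric: `dist (s, x) (t, x) = |s − t|`. -/
theorem dist_time_pair (s t : ℝ) (x : EuclideanSpace ℝ (Fin 3)) :
    dist ((s, x) : ℝ × EuclideanSpace ℝ (Fin 3)) (t, x) = |s - t| := by
  rw [Prod.dist_eq, dist_self, Real.dist_eq, max_eq_left (abs_nonneg _)]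

/-! ## The limit package at an off-apex point -/

set_option maxHeartbeats 400000 in
/-- **The limit package at `y₀ ≠ 0`.**  Along the zoom sequence of F3 converging to `U` in `L³_loc` (with `U`
continuous on the open backward slab and with differentiable slices): there are `C ≥ 0`, `α > 0` and a
subsequence `φ` such that (i) for all large `k` the gradients `D_x(w k)` are jointly `(C, α)`-Hölder on
`Q((0,y₀), ‖y₀‖/8)`; (ii) `D_x(w (φ j))(s, x) → D_x U(s, x)` at every point of `Q((0,y₀), ‖y₀‖/16)`; (iii) hence
`D_x U` is jointly `(C, α)`-Hölder on `Q((0,y₀), ‖y₀‖/16)` — up to the top time. -/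
theorem exists_limit_package {Cu : ℝ}
    {w : ℕ → ℝ → EuclideanSpace ℝ (Fin 3) → EuclideanSpace ℝ (Fin 3)} {π : ℕ → ℝ → EuclideanSpace ℝ (Fin 3) → ℝ}
    {Rk : ℕ → ℝ} {I : ℝ≥0} {U : ℝ → EuclideanSpace ℝ (Fin 3) → EuclideanSpace ℝ (Fin 3)}
    (hCu : 0 ≤ Cu) (hRk : Tendsto Rk atTop atTop)
    (hcl : ∀ k, IsClassicalNSSolutionOnRegion (parabolicCylinder (Rk k) (0 : ℝ × EuclideanSpace ℝ (Fin 3))) 1 0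
      (w k) (π k))
    (hone : ∀ k, ∀ z ∈ parabolicCylinder (Rk k) (0 : ℝ × EuclideanSpace ℝ (Fin 3)),
      ‖w k z.1 z.2‖ ≤ Cu / (Real.sqrt (-z.1) + ‖z.2‖))
    (hIk : ∀ k, typeIBound (parabolicCylinder (Rk k) (0 : ℝ × EuclideanSpace ℝ (Fin 3))) (w k) (π k)
      (fun t x => fderiv ℝ (w k t) x) ≤ I)
    (hUc : ContinuousOn (uncurry U) (Iio (0 : ℝ) ×ˢ univ))
    (hUd : ∀ s : ℝ, s < 0 → ∀ x : EuclideanSpace ℝ (Fin 3), DifferentiableAt ℝ (U s) x)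
    (hL3 : ∀ r : ℝ, 0 < r → Tendsto (fun k => eLpNorm (uncurry (w k) - uncurry U) 3
      (volume.restrict (parabolicCylinder r (0 : ℝ × EuclideanSpace ℝ (Fin 3))))) atTop (𝓝 0))
    {y₀ : EuclideanSpace ℝ (Fin 3)} (hy₀ : y₀ ≠ 0) :
    ∃ C α : ℝ, 0 < α ∧ 0 ≤ C ∧ ∃ φ : ℕ → ℕ, StrictMono φ ∧
      (∀ᶠ k in atTop, ∀ z ∈ parabolicCylinder (‖y₀‖ / 8) (((0 : ℝ), y₀) : ℝ × EuclideanSpace ℝ (Fin 3)),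
        ∀ z' ∈ parabolicCylinder (‖y₀‖ / 8) (((0 : ℝ), y₀) : ℝ × EuclideanSpace ℝ (Fin 3)),
          dist (fderiv ℝ (w k z.1) z.2) (fderiv ℝ (w k z'.1) z'.2) ≤ C * dist z z' ^ α) ∧
      (∀ z ∈ parabolicCylinder (‖y₀‖ / 16) (((0 : ℝ), y₀) : ℝ × EuclideanSpace ℝ (Fin 3)),
        Tendsto (fun j => fderiv ℝ (w (φ j) z.1) z.2) atTop (𝓝 (fderiv ℝ (U z.1) z.2))) ∧
      (∀ z ∈ parabolicCylinder (‖y₀‖ / 16) (((0 : ℝ), y₀) : ℝ × EuclideanSpace ℝ (Fin 3)),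
        ∀ z' ∈ parabolicCylinder (‖y₀‖ / 16) (((0 : ℝ), y₀) : ℝ × EuclideanSpace ℝ (Fin 3)),
          dist (fderiv ℝ (U z.1) z.2) (fderiv ℝ (U z'.1) z'.2) ≤ C * dist z z' ^ α) := by
  have hy : 0 < ‖y₀‖ := norm_pos_iff.2 hy₀
  obtain ⟨K, C, α₀, α₁, hα₀, hα₁, hC, hev⟩ := exists_zoom_regularity hCu hRk hcl hone hIk hy₀
  set Q₈ : Set (ℝ × EuclideanSpace ℝ (Fin 3)) :=
    parabolicCylinder (‖y₀‖ / 8) (((0 : ℝ), y₀) : ℝ × EuclideanSpace ℝ (Fin 3)) with hQ₈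
  have h16 := topCylinder_sixteenth_subset_eighth y₀
  -- a big origin cylinder containing `Q₈`, eventually inside the zoom domains
  set r : ℝ := ‖y₀‖ + ‖y₀‖ / 8 + 1 with hr_def
  have hr : 0 < r := by positivity
  have h8r : Q₈ ⊆ parabolicCylinder r (0 : ℝ × EuclideanSpace ℝ (Fin 3)) :=
    parabolicCylinder_top_subset (by positivity) (by rw [hr_def]; linarith)
  have hevR : ∀ᶠ k in atTop, parabolicCylinder r (0 : ℝ × EuclideanSpace ℝ (Fin 3)) ⊆
      parabolicCylinder (Rk k) (0 : ℝ × EuclideanSpace ℝ (Fin 3)) := by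
    filter_upwards [tendsto_atTop.1 hRk r] with k hk
    exact parabolicCylinder_mono hr.le hk _
  have hslab : parabolicCylinder r (0 : ℝ × EuclideanSpace ℝ (Fin 3)) ⊆ Iio (0 : ℝ) ×ˢ univ := by
    intro z hz
    rw [mem_parabolicCylinder] at hz
    exact ⟨by simpa using hz.1.2, mem_univ _⟩
  -- measurability on `Q(0,r)` and the a.e.-convergent subsequence
  have hwm : ∀ᶠ k in atTop, AEStronglyMeasurable (uncurry (w k))
      (volume.restrict (parabolicCylinder r (0 : ℝ × EuclideanSpace ℝ (Fin 3)))) := by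
    filter_upwards [hevR] with k hk
    exact ((hcl k).smooth_velocity.continuousOn.mono hk).aestronglyMeasurable
      (isOpen_parabolicCylinder _ _).measurableSet
  have hUm : AEStronglyMeasurable (uncurry U)
      (volume.restrict (parabolicCylinder r (0 : ℝ × EuclideanSpace ℝ (Fin 3)))) :=
    (hUc.mono hslab).aestronglyMeasurable (isOpen_parabolicCylinder _ _).measurableSet
  obtain ⟨φ, hφ, hae⟩ := exists_subseq_ae_tendsto_of_eLpNorm_three hwm hUm (hL3 r hr)
  have hφt : Tendsto φ atTop atTop := hφ.tendsto_atTop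
  have hev' := hφt.eventually hev
  have hevR' := hφt.eventually hevR
  -- everywhere convergence of the values on `Q₈` along `φ`
  have hae8 : ∀ᵐ z ∂(volume.restrict Q₈), Tendsto (fun j => uncurry (w (φ j)) z) atTop (𝓝 (uncurry U z)) :=
    ae_restrict_of_ae_restrict_of_subset h8r hae
  have hU8 : ContinuousOn (uncurry U) Q₈ := hUc.mono (h8r.trans hslab)
  have hH0 : ∀ᶠ j in atTop, ∀ z ∈ Q₈, ∀ z' ∈ Q₈,
      dist (uncurry (w (φ j)) z) (uncurry (w (φ j)) z') ≤ C * dist z z' ^ α₀ := by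
    filter_upwards [hev'] with j hj
    exact fun z hz z' hz' => hj.2.1 z hz z' hz'
  have hval : ∀ z ∈ Q₈, Tendsto (fun j => uncurry (w (φ j)) z) atTop (𝓝 (uncurry U z)) :=
    tendsto_of_ae_tendsto_of_equiHolder (isOpen_parabolicCylinder _ _) hae8 hU8 hα₀ hH0
  -- gradients converge on `Q₁₆` along `φ`
  have hgrad : ∀ z ∈ parabolicCylinder (‖y₀‖ / 16) (((0 : ℝ), y₀) : ℝ × EuclideanSpace ℝ (Fin 3)),
      Tendsto (fun j => fderiv ℝ (w (φ j) z.1) z.2) atTop (𝓝 (fderiv ℝ (U z.1) z.2)) := by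
    rintro ⟨s, x⟩ hz
    have hρ : 0 < ‖y₀‖ / 16 := by positivity
    have hlim : ∀ y ∈ ball x (‖y₀‖ / 16), Tendsto (fun j => w (φ j) s y) atTop (𝓝 (U s y)) :=
      fun y hy => hval (s, y) (mem_topCylinder_eighth_of_ball hz hy)
    have htaylor : ∀ᶠ j in atTop, ∀ h : EuclideanSpace ℝ (Fin 3), ‖h‖ < ‖y₀‖ / 16 →
        ‖w (φ j) s (x + h) - w (φ j) s x - fderiv ℝ (w (φ j) s) x h‖ ≤ K * ‖h‖ ^ 2 := by
      filter_upwards [hev', hevR'] with j hj hjR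
      intro h hh
      refine taylor_bound_of_iteratedFDeriv_two (fun y hy => ?_) (fun y hy => ?_) hh
      · have hmem : ((s, y) : ℝ × EuclideanSpace ℝ (Fin 3)) ∈
            parabolicCylinder (Rk (φ j)) (0 : ℝ × EuclideanSpace ℝ (Fin 3)) :=
          hjR (h8r (mem_topCylinder_eighth_of_ball hz hy))
        have h1 := (hcl (φ j)).contDiffAt_velocity (isOpen_parabolicCylinder _ _) hmem
        have h2 : ContDiffAt ℝ (⊤ : ℕ∞) (w (φ j) s) y :=
          h1.comp y (contDiffAt_const.prodMk contDiffAt_id)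
        exact h2.of_le (by norm_cast)
      · exact hj.1 (s, y) (mem_topCylinder_eighth_of_ball hz hy) 2 le_rfl
    exact tendsto_fderiv_of_tendsto_of_taylor hρ hlim htaylor (hUd s (neg_of_mem_topCylinder hz) x)
  refine ⟨C, α₁, hα₁, hC, φ, hφ, ?_, hgrad, fun z hz z' hz' => ?_⟩
  · filter_upwards [hev] with k hk
    exact hk.2.2
  · refine le_of_tendsto ((hgrad z hz).dist (hgrad z' hz')) ?_
    filter_upwards [hev'] with j hj
    exact hj.2.2 z (h16 hz) z' (h16 hz')

/-! ## The time-Hölder modulus of `curl U` near an off-apex point, up to the top -/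

/-- From the limit package: near `y₀ ≠ 0` the curls `curl U(s, x)` have a Hölder modulus of continuity in time on
`(−(‖y₀‖/16)², 0) × B(y₀, ‖y₀‖/16)`. -/
theorem curl_holder_time_of_package {U : ℝ → EuclideanSpace ℝ (Fin 3) → EuclideanSpace ℝ (Fin 3)}
    {y₀ : EuclideanSpace ℝ (Fin 3)} {C α : ℝ}
    (hH : ∀ z ∈ parabolicCylinder (‖y₀‖ / 16) (((0 : ℝ), y₀) : ℝ × EuclideanSpace ℝ (Fin 3)),
        ∀ z' ∈ parabolicCylinder (‖y₀‖ / 16) (((0 : ℝ), y₀) : ℝ × EuclideanSpace ℝ (Fin 3)),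
          dist (fderiv ℝ (U z.1) z.2) (fderiv ℝ (U z'.1) z'.2) ≤ C * dist z z' ^ α) :
    ∀ s ∈ Ioo (-(‖y₀‖ / 16) ^ 2) (0 : ℝ), ∀ t ∈ Ioo (-(‖y₀‖ / 16) ^ 2) (0 : ℝ), ∀ x ∈ ball y₀ (‖y₀‖ / 16),
      dist (curl (U t) x) (curl (U s) x) ≤ ‖curlCLM‖ * C * |t - s| ^ α := by
  intro s hs t ht x hx
  have hzs : ((s, x) : ℝ × EuclideanSpace ℝ (Fin 3)) ∈
      parabolicCylinder (‖y₀‖ / 16) (((0 : ℝ), y₀) : ℝ × EuclideanSpace ℝ (Fin 3)) := by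
    rw [mem_parabolicCylinder_top_iff]; exact ⟨hs, mem_ball.1 hx⟩
  have hzt : ((t, x) : ℝ × EuclideanSpace ℝ (Fin 3)) ∈
      parabolicCylinder (‖y₀‖ / 16) (((0 : ℝ), y₀) : ℝ × EuclideanSpace ℝ (Fin 3)) := by
    rw [mem_parabolicCylinder_top_iff]; exact ⟨ht, mem_ball.1 hx⟩
  have h := hH (t, x) hzt (s, x) hzs
  rw [dist_time_pair] at h
  calc dist (curl (U t) x) (curl (U s) x)
      ≤ ‖curlCLM‖ * dist (fderiv ℝ (U t) x) (fderiv ℝ (U s) x) := dist_curl_le _ _ _ _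
    _ ≤ ‖curlCLM‖ * (C * |t - s| ^ α) := by gcongr
    _ = ‖curlCLM‖ * C * |t - s| ^ α := by ring

/-! ## F4a -/

set_option maxHeartbeats 800000 in
/-- **F4a (TOP CURL TRACE + POCKET)** (PK1 skeleton, verbatim): uniform off-apex regularity of the zooms up to
the top (Seregin–Šverák 2009 §2 with the ball-mean pressure gauge, mass `≤ c²·𝐈`), `L³ + equi-Hölder ⇒
pointwise`, values ⇒ gradients, the inherited time-Hölder modulus of `curl U` ⇒ the top trace `Ω₀`, its
continuity off the apex, `TopCurlTendsto U Ω₀`, and the vanishing of `Ω₀` on the pocket `B(e, κ)`. -/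
theorem exists_topCurl_of_classZoom {Cu κ : ℝ}
    {w : ℕ → ℝ → EuclideanSpace ℝ (Fin 3) → EuclideanSpace ℝ (Fin 3)} {π : ℕ → ℝ → EuclideanSpace ℝ (Fin 3) → ℝ}
    {Rk : ℕ → ℝ} {ek : ℕ → EuclideanSpace ℝ (Fin 3)} {εk : ℕ → ℝ} {I : ℝ≥0} {e : EuclideanSpace ℝ (Fin 3)}
    {U : ℝ → EuclideanSpace ℝ (Fin 3) → EuclideanSpace ℝ (Fin 3)} {P : ℝ → EuclideanSpace ℝ (Fin 3) → ℝ}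
    {H : ℝ → EuclideanSpace ℝ (Fin 3) → EuclideanSpace ℝ (Fin 3) →L[ℝ] EuclideanSpace ℝ (Fin 3)}
    (hCu : 0 < Cu) (hκ : 0 < κ) (hκ1 : κ < 1)
    (hRk1 : ∀ k, 1 ≤ Rk k) (hRk : Tendsto Rk atTop atTop)
    (hcl : ∀ k, IsClassicalNSSolutionOnRegion (parabolicCylinder (Rk k) (0 : ℝ × EuclideanSpace ℝ (Fin 3))) 1 0
      (w k) (π k))
    (hone : ∀ k, ∀ z ∈ parabolicCylinder (Rk k) (0 : ℝ × EuclideanSpace ℝ (Fin 3)),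
      ‖w k z.1 z.2‖ ≤ Cu / (Real.sqrt (-z.1) + ‖z.2‖))
    (hIk : ∀ k, typeIBound (parabolicCylinder (Rk k) (0 : ℝ × EuclideanSpace ℝ (Fin 3))) (w k) (π k)
      (fun t x => fderiv ℝ (w k t) x) ≤ I)
    (hek1 : ∀ k, ‖ek k‖ = 1) (hek : Tendsto ek atTop (𝓝 e)) (hε0 : ∀ k, 0 ≤ εk k)
    (hε : Tendsto εk atTop (𝓝 0))
    (hpocket : ∀ k, ∀ y ∈ ball (ek k) κ, ∀ᶠ s in 𝓝[<] (0 : ℝ), ‖curl (w k s) y‖ ≤ εk k)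
    (hU : IsTypeIAncientMild Cu U)
    (hsw : IsSuitableWeakSolutionOn
      (Literature.Analysis.FluidPDE.slab (EuclideanSpace ℝ (Fin 3)) (Set.Iio (0 : ℝ)) isOpen_Iio) 1 0 U P)
    (hwg : HasWeakSpatialGradientOn
      (Literature.Analysis.FluidPDE.slab (EuclideanSpace ℝ (Fin 3)) (Set.Iio (0 : ℝ)) isOpen_Iio) U H)
    (hIU : typeIBound (Iio (0 : ℝ) ×ˢ univ) U P H < ⊤)
    (hL3 : ∀ r : ℝ, 0 < r → Tendsto (fun k => eLpNorm (uncurry (w k) - uncurry U) 3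
      (volume.restrict (parabolicCylinder r (0 : ℝ × EuclideanSpace ℝ (Fin 3))))) atTop (𝓝 0)) :
    ∃ Ω₀ : EuclideanSpace ℝ (Fin 3) → EuclideanSpace ℝ (Fin 3),
      ContinuousOn Ω₀ ({0}ᶜ : Set (EuclideanSpace ℝ (Fin 3))) ∧ TopCurlTendsto U Ω₀ ∧
        ∀ y ∈ ball e κ, Ω₀ y = 0 := by
  -- interface bookkeeping: these registered hypotheses are not needed by the present proof
  have _h₁ := hRk1; have _h₂ := hek1; have _h₃ := hε0; have _h₄ := hsw; have _h₅ := hwg; have _h₆ := hIU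
  have _h₇ := hκ
  -- the limit: continuous on the open slab, smooth slices
  have hUsm : ContDiffOn ℝ (⊤ : ℕ∞) (uncurry U) (Iio (0 : ℝ) ×ˢ univ) := hU.1
  have hUc : ContinuousOn (uncurry U) (Iio (0 : ℝ) ×ˢ univ) := hUsm.continuousOn
  have hslab_open : IsOpen (Iio (0 : ℝ) ×ˢ (univ : Set (EuclideanSpace ℝ (Fin 3)))) :=
    isOpen_Iio.prod isOpen_univ
  have hUslice : ∀ s : ℝ, s < 0 → ContDiff ℝ (⊤ : ℕ∞) (U s) := by
    intro s hs
    rw [contDiff_iff_contDiffAt]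
    intro x
    have h1 : ContDiffAt ℝ (⊤ : ℕ∞) (uncurry U) (s, x) :=
      hUsm.contDiffAt (hslab_open.mem_nhds ⟨hs, mem_univ _⟩)
    exact h1.comp x (contDiffAt_const.prodMk contDiffAt_id)
  have hUd : ∀ s : ℝ, s < 0 → ∀ x : EuclideanSpace ℝ (Fin 3), DifferentiableAt ℝ (U s) x :=
    fun s hs x => ((hUslice s hs).differentiable (by simp)).differentiableAt
  have hUcurlc : ∀ s : ℝ, s < 0 → Continuous (curl (U s)) := by
    intro s hs
    rw [curl_eq_curlCLM_comp]
    exact curlCLM.continuous.comp ((hUslice s hs).continuous_fderiv (by simp))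
  -- the top trace
  set Ω₀ : EuclideanSpace ℝ (Fin 3) → EuclideanSpace ℝ (Fin 3) :=
    fun x => limUnder (𝓝[<] (0 : ℝ)) (fun s => curl (U s) x) with hΩ₀
  -- the local uniform convergence to the trace near every `x₁ ≠ 0`
  have hpack := fun (y₀ : EuclideanSpace ℝ (Fin 3)) (hy₀ : y₀ ≠ 0) =>
    exists_limit_package hCu.le hRk hcl hone hIk hUc hUd hL3 hy₀
  have hunif : ∀ x₁ : EuclideanSpace ℝ (Fin 3), x₁ ≠ 0 →
      TendstoUniformlyOn (fun s x => curl (U s) x) Ω₀ (𝓝[<] (0 : ℝ)) (ball x₁ (‖x₁‖ / 16)) := by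
    intro x₁ hx₁
    obtain ⟨C, α, hα, -, φ, -, -, -, hHU⟩ := hpack x₁ hx₁
    have hη : 0 < (‖x₁‖ / 16) ^ 2 := by have := norm_pos_iff.2 hx₁; positivity
    exact tendstoUniformlyOn_limUnder_of_holder_time (F := fun s x => curl (U s) x) hη hα
      (curl_holder_time_of_package hHU)
  refine ⟨Ω₀, ?_, ?_, ?_⟩
  · -- continuity of the trace off the apex
    intro x₁ hx₁
    have hx₁' : x₁ ≠ 0 := hx₁
    have hδ : 0 < ‖x₁‖ / 16 := by have := norm_pos_iff.2 hx₁'; positivity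
    have hc : ContinuousOn Ω₀ (ball x₁ (‖x₁‖ / 16)) := by
      refine (hunif x₁ hx₁').continuousOn (Filter.Eventually.frequently ?_)
      filter_upwards [self_mem_nhdsWithin] with s hs
      exact (hUcurlc s hs).continuousOn
    exact (hc.continuousAt (ball_mem_nhds x₁ hδ)).continuousWithinAt
  · -- `TopCurlTendsto U Ω₀`
    intro x₁ hx₁ θ hθ
    have hδ : 0 < ‖x₁‖ / 16 := by have := norm_pos_iff.2 hx₁; positivity
    have hev := (Metric.tendstoUniformlyOn_iff.1 (hunif x₁ hx₁)) θ hθ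
    obtain ⟨s₀, hs₀, hs₀1, hwin⟩ := exists_window_of_eventually_nhdsLT hev
    refine ⟨s₀, ‖x₁‖ / 16, hs₀, hs₀1, hδ, fun s hs x hx => ?_⟩
    have h := hwin s hs x hx
    rw [dist_comm, dist_eq_norm] at h
    exact h.le
  · -- the pocket
    intro y hy
    have hy0 : y ≠ 0 := by
      intro h0
      rw [h0, mem_ball, dist_comm, dist_zero_right] at hy
      have he1 : ‖e‖ = 1 := by
        have := tendsto_nhds_unique (hek.norm) (by simp [hek1] : Tendsto (fun k => ‖ek k‖) atTop (𝓝 1))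
        exact this
      linarith
    have hyn : 0 < ‖y‖ := norm_pos_iff.2 hy0
    obtain ⟨C, α, hα, hC, φ, hφ, hHk, hgrad, hHU⟩ := hpack y hy0
    have hφt : Tendsto φ atTop atTop := hφ.tendsto_atTop
    -- the trace at `y` is the limit of `curl U(s, y)`
    have hη : 0 < (‖y‖ / 16) ^ 2 := by positivity
    have htrace : Tendsto (fun s => curl (U s) y) (𝓝[<] (0 : ℝ)) (𝓝 (Ω₀ y)) :=
      tendsto_limUnder_of_holder_time (F := fun s x => curl (U s) x) hη hα
        (curl_holder_time_of_package hHU) (mem_ball_self (by positivity))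
    -- eventually `y` lies in the moving pocket
    have hyk : ∀ᶠ k in atTop, y ∈ ball (ek k) κ := by
      have hlt : dist y e < κ := mem_ball.1 hy
      have h1 : Tendsto (fun k => dist y (ek k)) atTop (𝓝 (dist y e)) := tendsto_const_nhds.dist hek
      filter_upwards [h1 (Iio_mem_nhds hlt)] with k hk
      exact mem_ball.2 hk
    -- the key bound: for `s ∈ (−(‖y‖/16)², 0)` and all large `k`
    have hkey : ∀ s ∈ Ioo (-(‖y‖ / 16) ^ 2) (0 : ℝ),
        ‖curl (U s) y‖ ≤ ‖curlCLM‖ * C * (-s) ^ α := by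
      intro s hs
      have hzs : ((s, y) : ℝ × EuclideanSpace ℝ (Fin 3)) ∈
          parabolicCylinder (‖y‖ / 16) (((0 : ℝ), y) : ℝ × EuclideanSpace ℝ (Fin 3)) := by
        rw [mem_parabolicCylinder_top_iff]; exact ⟨hs, by simpa using hyn⟩
      -- the bound for the zooms, all large `k`
      have hzoom : ∀ᶠ k in atTop, ‖curl (w k s) y‖ ≤ ‖curlCLM‖ * C * (-s) ^ α + εk k := by
        filter_upwards [hHk, hyk] with k hk hyk'
        obtain ⟨s₁, hs₁, -, hwin⟩ := exists_window_of_eventually_nhdsLT (hpocket k y hyk')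
        -- a time `s'` with `max s s₁ < s' < 0`
        set s' : ℝ := max s s₁ / 2 with hs'_def
        have hms : max s s₁ < 0 := max_lt hs.2 hs₁
        have hs'1 : max s s₁ < s' := by rw [hs'_def]; linarith
        have hs'0 : s' < 0 := by rw [hs'_def]; linarith
        have hss' : s < s' := (le_max_left _ _).trans_lt hs'1
        have hs₁s' : s₁ < s' := (le_max_right _ _).trans_lt hs'1
        have hq : ‖curl (w k s') y‖ ≤ εk k := hwin s' ⟨hs₁s', hs'0⟩
        have h8s : ((s, y) : ℝ × EuclideanSpace ℝ (Fin 3)) ∈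
            parabolicCylinder (‖y‖ / 8) (((0 : ℝ), y) : ℝ × EuclideanSpace ℝ (Fin 3)) :=
          topCylinder_sixteenth_subset_eighth y hzs
        have h8s' : ((s', y) : ℝ × EuclideanSpace ℝ (Fin 3)) ∈
            parabolicCylinder (‖y‖ / 8) (((0 : ℝ), y) : ℝ × EuclideanSpace ℝ (Fin 3)) := by
          rw [mem_parabolicCylinder_top_iff] at h8s ⊢
          exact ⟨⟨by linarith [h8s.1.1], hs'0⟩, h8s.2⟩
        have hmod := hk (s, y) h8s (s', y) h8s'
        rw [dist_time_pair] at hmod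
        have habs : |s - s'| ≤ -s := by rw [abs_sub_comm, abs_of_pos (by linarith)]; linarith
        have hrpow : |s - s'| ^ α ≤ (-s) ^ α := Real.rpow_le_rpow (abs_nonneg _) habs hα.le
        calc ‖curl (w k s) y‖ ≤ dist (curl (w k s) y) (curl (w k s') y) + ‖curl (w k s') y‖ := by
              rw [dist_eq_norm]; exact norm_le_norm_sub_add _ _
          _ ≤ ‖curlCLM‖ * dist (fderiv ℝ (w k s) y) (fderiv ℝ (w k s') y) + εk k :=
              add_le_add (dist_curl_le _ _ _ _) hq
          _ ≤ ‖curlCLM‖ * (C * |s - s'| ^ α) + εk k := by gcongr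
          _ ≤ ‖curlCLM‖ * (C * (-s) ^ α) + εk k := by gcongr
          _ = ‖curlCLM‖ * C * (-s) ^ α + εk k := by ring
      -- pass to the limit along `φ`
      have hconv : Tendsto (fun j => curl (w (φ j) s) y) atTop (𝓝 (curl (U s) y)) := by
        have h := hgrad (s, y) hzs
        simp only [curl_eq_curlCLM]
        exact (curlCLM.continuous.tendsto _).comp h
      have hrhs : Tendsto (fun j => ‖curlCLM‖ * C * (-s) ^ α + εk (φ j)) atTop
          (𝓝 (‖curlCLM‖ * C * (-s) ^ α + 0)) :=
        tendsto_const_nhds.add (hε.comp hφt)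
      rw [add_zero] at hrhs
      exact le_of_tendsto_of_tendsto hconv.norm hrhs (hφt.eventually hzoom)
    -- let `s ↑ 0`
    have hlim0 : Tendsto (fun s : ℝ => ‖curlCLM‖ * C * (-s) ^ α) (𝓝[<] (0 : ℝ)) (𝓝 0) := by
      have h1 : Tendsto (fun s : ℝ => (-s) ^ α) (𝓝 (0 : ℝ)) (𝓝 ((-0 : ℝ) ^ α)) :=
        ((Real.continuous_rpow_const hα.le).comp continuous_neg).tendsto 0
      rw [neg_zero, Real.zero_rpow hα.ne'] at h1
      simpa using (h1.const_mul (‖curlCLM‖ * C)).mono_left nhdsWithin_le_nhds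
    have hev0 : ∀ᶠ s in 𝓝[<] (0 : ℝ), ‖curl (U s) y‖ ≤ ‖curlCLM‖ * C * (-s) ^ α := by
      filter_upwards [Ioo_mem_nhdsLT (show -(‖y‖ / 16) ^ 2 < (0 : ℝ) by linarith)] with s hs
      exact hkey s hs
    have h0 : ‖Ω₀ y‖ ≤ 0 := le_of_tendsto_of_tendsto htrace.norm hlim0 hev0
    exact norm_le_zero_iff.1 h0

end Summit.NavierStokesRegularity.NavierStokesRegularity.Theorems.QuietScarPocketDoor

end
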